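import Mathlib
import Mathlib.Analysis.Asymptotics.AsymptoticEquivalent
import Mathlib.Analysis.SpecialFunctions.Log.Basic
import Mathlib.NumberTheory.LegendreSymbol.ZModChar
import Mathlib.Logic.Equiv.Fin.Basic
import Literature.NumberTheory.Sieve.SingularSeries
import Literature.NumberTheory.Sieve.BatemanHorn
import HarnessLib.Audit
import Literature.NumberTheory.Sieve.ParityBatemanHorn
import HarnessLib

/-!
# HardyLittlewoodConjE — CONJECTURE (obligation of Parity/BatemanHorn)

Unproven conjecture migrated by the gate from `Literature/NumberTheory/Sieve/ParityBatemanHorn.lean` (`Literature.NumberTheory.Sieve.HardyLittlewoodConjE`): unproven conjectures are obligations of our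
theories, not literature facts (human ruling 2026-08-15). Provenance: HardyLittlewoodPN3. Routes use it as a crux item or via
`--conditional-bridge --conditional-on HardyLittlewoodConjE`; a proof goes in the sibling `Theorems/HardyLittlewoodConjEHolds.lean` as `theorem HardyLittlewoodConjE_holds : HardyLittlewoodConjE` so this file stays a conjecture LEAF that Literature/ may import.
-/

namespace Summit.Parity.BatemanHorn

open Literature Literature.NumberTheory Literature.NumberTheory.Sieve
open Filter Finset Polynomial Asymptotics
open scoped Topology
universe u

/-- OPEN CONJECTURE — **parity.S37**, **Hardy–Littlewood's Conjecture E** (primes `m² + 1`), posed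
in G. H. Hardy, J. E. Littlewood, *Some problems of 'Partitio numerorum'; III*, Acta Math. 44
(1923), 1–70, §5.42, p. 48 ("Thus finally we are led to Conjecture E. There are infinitely
many primes of the form `m² + 1`. The number `P(n)` of such primes less than `n` is given
asymptotically by `P(n) ∼ C √n / log n`, where `C = ∏_{ϖ=3}^{∞} (1 - (1/(ϖ - 1)) (−1/ϖ))`";
the heuristic is §5.41, p. 46, on the third of Landau's 1912 problems; restated as the case
`f = X² + 1` of Bateman–Horn, Math. Comp. 16 (1962), §3, and as Guy's problem A1)
[status: open].
The `Prop`, in the Bateman–Horn parametrisation `m ≤ x` (`x = √n`): there is a constant `𝔖`, the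
*ordered* conditionally convergent Euler product
`𝔖 = ∏_{p > 2} (1 - χ₋₄(p)/(p - 1)) = lim_{x → ∞} ∏_{2 < p ≤ x} (1 - χ₋₄(p)/(p - 1))`, such that
`#{1 ≤ n ≤ x : n² + 1 prime} ~ (𝔖 / 2) · x / log x`.
**Relation to the source (faithful).** This is equivalent to Conjecture E *as printed*
(infinitely many primes `m² + 1`, and `P(n) ∼ C √n / log n` with the printed product `C`): proved
in the tree as `Literature.NumberTheory.Sieve.hardyLittlewoodConjE_iff_printed`
(`ParityBatemanHornProofs.lean`; the reparametrisation `P(n) = Q(⌊√(n − 2)⌋)`, `Q(x) = P(x² + 2)`).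
The product does converge, unconditionally (`tendsto_hardyLittlewoodE_partial_holds`, to
`hardyLittlewoodEConst > 0`), so the conjecture is equivalent to the bare asymptotic
(`hardyLittlewoodConjE_iff_isEquivalent`), and it is the case `f = X² + 1` of
`BatemanHornConjecture` (`hardyLittlewoodConjE_of_batemanHorn_holds`).
**Status (re-verified 2026-08-15): open.** It implies Landau's problem — `n² + 1` is prime for
infinitely many `n` (`HardyLittlewoodConjE.landauConjecture`) — which is open: "we don't know of
any integer polynomial, of degree greater than one, for which it has been proved that it takes an
infinity of prime values" (Guy, *Unsolved Problems in Number Theory* (1994), §A1); the best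
unconditional result is `n² + 1 = P₂` infinitely often (Iwaniec, Invent. Math. 47 (1978), 171–188).
Registered open statement, not a dischargeable literature fact: no `HardyLittlewoodConjE_holds` is
to be expected; use it as a hypothesis `(h : HardyLittlewoodConjE)`. Name kept (it has users, see
the module docstring "Registry"). [cite: HardyLittlewoodPN3, §5.42 p. 48, Conjecture E] -/
@[conjecture] def HardyLittlewoodConjE : Prop :=
  ∃ C : ℝ,
    Tendsto (fun x : ℕ ↦ ∏ p ∈ (Nat.primesLE x).filter (2 < ·),
      (1 - (ZMod.χ₄ p : ℝ) / ((p : ℝ) - 1))) atTop (𝓝 C) ∧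
    (fun x : ℕ ↦ (nSqAddOnePrimeCount x : ℝ)) ~[atTop]
      fun x : ℕ ↦ C / 2 * (x : ℝ) / Real.log x

end Summit.Parity.BatemanHorn
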